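import Literature.MathematicalPhysics.QuantumFieldTheory.Balaban1983to89.B9B8KnitLetterHprimeBounds

/-!
# `Balaban1983to89.B9B8KnitLetterHprimeLap` — [B8] (1.92)'s THIRD LINE `(Lʲη)²|Δ^η_{U₀}H′X| ≦ B₀|X|` FOR `H′ = G′²Q′*(Q′G′²Q′*)⁻¹` AT THE KNIT LETTER
# `parKnitY`: since `Δ′_a(U)G′(U) = 1` ([B9] p. 394), `Δ′_a(H′X) = G′Q′*(Q′G′²Q′*)⁻¹X` and `−Δ_U = Δ′_a − Σ_j a_j(Lʲη)⁻²Q′_j*Q′_j` ((3.24)); the short word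
# `G′·Q′*·(Q′G′²Q′*)⁻¹` is `O((Lʲη)⁻²)` by the (3.42)₁ ∕ (3.48) block majorants «using again Lemma 2.1», and the averaging term is `a_j(Lʲη)⁻²·O(|H′X|)` by
# the sup line (E6) — the consumer's law (E8) `hp_lap` of `B8Thm2TorusLetters.LettersAt` at print's own transporters, read through the knit's own covariant
# Laplacian `covLap` at the box points (junction J-B file 19)

statement-level skeleton of published theorems with citation tags; proofs where landed; nothing here is a claim about the
Yang–Mills mass gap

T. Bałaban, *Spaces of regular gauge field configurations on a lattice and gauge fixing conditions*, Commun. Math. Phys. **99** (1985) 75–102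
[`Balaban1985RegularSpaces`, "[B8]"]; T. Bałaban, *Propagators for lattice gauge theories in a background field*, Commun. Math. Phys. **99** (1985) 389–434
[`Balaban1985BackgroundPropagators`, "[B9]"]; T. Bałaban, *Propagators and renormalization transformations for lattice gauge theories. II*, Commun. Math.
Phys. **96** (1984) 223–250 [`Balaban1984PropagatorsII`, "[4]"].

THE PRINT.  [B8] (1.91)–(1.92) p. 91: `H′ = G′²Q′*(Q′G′²Q′*)⁻¹` and *«|H′X|, (Lʲη)|∇^η_{U₀}H′X|, (Lʲη)²|Δ^η_{U₀}H′X| ≦ B₀|X| for x ∈ Ω_j»* (the consumer's (E8)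
`hp_lap`: `Bd2 … (covLap η U₀ (H′X)) (B₂′‖X‖)`, i.e. `(Lʲη)²‖Δ^η_{U₀}(H′X)(x)‖ ≦ B₂′‖X‖`, `j ≦ n`).  [B9] (3.23)–(3.24) p. 394: `Δ′_a(U) = −Δ^η_U + Σ_j a_j(Lʲη)⁻²
Q′_j(U)*Q′_j(U)` (on the torus member the characteristic functions are `1`), p. 394 «Its inverse is denoted by G′»; Theorem 3.1 (3.42)₁ p. 397, Theorem 3.2
(3.48) p. 398, p. 399 (3.49) «using again Lemma 2.1»; [4] (2.14) p. 225 (the averaging weights), (2.52) p. 232, (2.61) p. 234.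

WHY THIS FILE ∕ THE ARGUMENT.  `Δ′_a(U)·H′ = (Δ′_aG′)·G′Q′*C = G′Q′*C` (`C = (Q′G′²Q′*)⁻¹`; junction file 3's `deltaPrimeAY_GpY_parKnitY_apply`), so def-Y's unit-lattice
covariant Laplacian of `H′Y` is `lapS(H′Y) = (G′Q′*CY) − (averaging term of Δ′_a)(H′Y)` (`deltaPrimeAY_apply`).  (i) The short word `η²G′·Q′*·sC`
(`η²·η²·s = 1`) typed block → site has, by one `hasMajorantHom_local_comp` (block-local `Q′*`, M5.6 FILE 3b) and one `hasMajorantHom_comp_decay` (r06; [4]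
(2.52) + (2.61) + the p. 398 transfer of `ℓ⁻⁴`), the two-space majorant `κ′·ℓ²·ℓ⁻⁴·e^{−ρd}`, `κ′ = (M₂Σ‖b_j‖)AKΛc₁`; read back (junction file 18's
`norm_hom_apply_le_of_hasMajorantHom_exp`) on a constant-level-`n` member (`ℓ = Lⁿη`): `L^{2n}‖(G′Q′*CY)(z)‖ ≦ (Σ‖b_j‖)κ′cM₂·sup‖Y‖`.  (ii) The averaging term at
ANY `G`-valued transporter letter is a block average of contractive conjugations with total weight `a_j(Lʲ)⁻²` (lattice units; [4] (2.14)), so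
`L^{2j}‖avg(Λ)(z)‖ ≦ a_j·max_{Δ(z)}‖Λ‖ ≦ max‖Λ‖`, and `max‖H′Y‖` is junction file 18's (E6).  (iii) J-A's `covLap_liftY`: the knit's `Δ^{η′}_{U₀}` of the periodic
lift of `H′Y` at a box point is `η′⁻²·lapS(H′Y)`, so `(Lʲη′)²‖Δ^{η′}_{U₀}(H′Y)♯(z)‖ = L^{2j}‖lapS(H′Y)(z)‖ ≦ B₂′·sup‖Y‖` for `j ≦ n` with
`B₂′ = (Σ‖b_j‖)(κ′ + κ_H)cM₂` — free of the member, `n`, `k`, `N`, `η′`.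

CITATION HEADER (lean-in-tree rule).  Cell `lit-balaban`, sub-row G-B9-LETTERS, junction J-B file 19 → seat `lit-balaban-p33` gen 95.  REUSED BY NAME: r06
`B9Ineq349Hom.{hasMajorantHom_comp_decay, hasMajorantHom_local_comp, hasMajorantHom_rate_mono}`, pv21 `B6RandomWalkHom.*`, p21 `B9Thm39CinvSandwichQ.
hasMajorantHom_conjHom_QpsY`, `B9Eq376POneLetters.{conjHom, conjHom_comp, conjHom_eq_conj}`, def-Y `Node00.{deltaPrimeAY_apply, avgCoeffY, avgTrY, lapS}`,
dag-n06-j `B9Thm311DeltaPrimeSymm.avgCoeffY_eq_ite`, `B9Thm311DeltaPrimePos.levC_blk_pos ∕ one_le_level`, dag-w1 `B9Thm31SiteCoerciveGaugeBlockY.{filter_rblk_eq_filter_blkOf,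
isBlockUnion_XB, two_le_side}`, `B9Thm31SiteCoerciveReg335Y.levC_mul_side_pow`, `B4Lower18.card_filter_rblk`, `B9Eq360Vprime.norm_R_le_of_unit`, J-A
`B9B8CarrierDictionary.covLap_liftY`, J-B 2 `boxEquiv_transl_of_mem`, J-B 3 `deltaPrimeAY_GpY_parKnitY_apply`, J-B 6 `contraction_of_mem_unitary`, J-B 17
(`parKnitY_contractive`, `geo9K_len_constLev`, `scaleTransfer_of_constLev`), J-B 18 (`norm_hom_apply_le_of_hasMajorantHom_exp`, `knit_E6_constLev`).

WHAT THIS FILE PROVES (sorry-free; no definitions; the block majorants and the geometry are DISPLAYED HYPOTHESES of the printed shapes).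
* §1 generic letters: `smul_shortword_restrictScalars`, `conjHom_shortword`, ★★ `hasMajorantHom_shortword` (`conj b(tG′) ∘ conjHom b(Q′*) ∘ conj b(sX⁻¹) ≺
  (M₂Σ‖b_j‖)AKΛc₁ · ℓ²ℓ⁻⁴ · e^{−ρd}`, `ρ + (α+β)δ₀ ≦ δ`), ★★ `hasMajorantHom_conj_GQC` (the same for `conjHom b((t·s)·G′Q′*X⁻¹)`).
* §2 ★★ `norm_avgTerm_apply_le` — def-Y's averaging term at ANY `G`-valued transporter letter: `‖Σ_w a(z,w)R(τ)Λ(w)‖ ≦ a_j(L^{j})⁻²·M` for `‖Λ‖ ≦ M` on the block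
  of `z`; `norm_avgTerm_apply_le'` (`a_j ≦ 1`).
* §3 at the knit letter: `lapS_Hprime_apply` (`lapS(H′Y) = G′Q′*CY − avg(H′Y)`), `scale_aux2`, ★★ `sqL_norm_GQC_parKnitY_apply_le` (`L^{2n}‖(G′Q′*CY)(z)‖ ≦ …`),
  ★★★ **`knit_E8_constLev`** (`L^{2j}‖lapS(H′Y)(z)‖ ≦ (Σ‖b_j‖)(κ′ + κ_H)cM₂·M`, `j ≦ n`), ★★★ **`knit_E8_at_box`** (the consumer's letter:
  `(Lʲη′)²‖covLap η′ (liftCfg U) (liftFun((H′Y) ∘ chart)) z‖ ≦ …` at every box point, `η′ ≠ 0`).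

HONEST SCOPE.  Bookkeeping in [4]'s block-majorant calculus plus the elementary block-average estimate of the (3.24) weights; the (3.42)₁ majorant of
`η²G′(U; parKnitY)` and the (3.48)-shape majorant of `s·(Q′G′²Q′*)⁻¹(U; parKnitY)` (suppliers: junction file 15; M5.6 at `parS := parKnitY`) are HYPOTHESES
here, as are (2.54), (2.61) and the row sum; the box-point reading is for the constant-level member (the consumer's `Ω_j = T_η`).  Count-neutral; nothing
continuum, nothing about OS axioms or the mass gap.  No `sorry`, no `axiom`, no `instance`, no `notation`.  NEW file; nothing landed is modified.  Net new
unproved facts: 0.  Seat `lit-balaban-p33` gen 95, 2026-08-28.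
-/

noncomputable section

namespace Literature.MathematicalPhysics.QuantumFieldTheory.Balaban1983to89.B9B8KnitLetterHprimeLap

open Node00 B6KLevelCensusIndexV1 B6Geom246MultiLevelBox B6MultiLevelBoxOperator B9BackgroundsKLevelV1 B9Eq39Adjoint
open B6RandomWalk (HasMajorant Triangle254 Ineq261 hasMajorant_mono c1_nonneg)
open B6RandomWalkHom (HasMajorantHom hasMajorantHom_mono hasMajorantHom_iff)
open B9Thm34Ext (toB6)
open B9GeoNormsKLevelV1 (geo9K geo9K_len_kGeo)
open B9Eq352DivFormLetters (conj)
open B9Eq376POneLetters (conjHom conjHom_comp conjHom_eq_conj)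
open B9Ineq347 (ScaleTransfer)
open B9Ineq349Hom (hasMajorantHom_comp_decay hasMajorantHom_local_comp hasMajorantHom_rate_mono)
open B9Thm39CinvSandwichQ (hasMajorantHom_conjHom_QpsY)
open B9Ineq349SiteComposite (etaS_pos)
open B6Prop22KLevelTorusCensusEta (nKT)
open B9Thm311DeltaPrimeSymm (avgCoeffY_eq_ite)
open B9Thm311DeltaPrimePos (levC_blk_pos one_le_level)
open B9Thm31SiteCoerciveGaugeBlockY (filter_rblk_eq_filter_blkOf isBlockUnion_XB two_le_side)
open B9Thm31SiteCoerciveReg335Y (levC_mul_side_pow)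
open B9Eq360Vprime (norm_R_le_of_unit)
open B6GlobalChartV1 (boxEquiv)
open B10Eq27TorusAxialLog (transl)
open B8Eq138LandauZd (covLap)
open B9B8CarrierDictionary (liftCfg liftFun covLap_liftY)
open B9B8AveragingJunction (parKnitY levY_of_blkOf boxEquiv_transl_of_mem)
open B9B8DeltaPrimeJunction (deltaPrimeAY_sub_lapS)
open B9Thm311PositivityKnitLetter (deltaPrimeAY_GpY_parKnitY_apply)
open B9B8KnitLetterCoercive (contraction_of_mem_unitary)
open B9B8KnitLetterRBound (parKnitY_contractive geo9K_len_constLev scaleTransfer_of_constLev)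
open B9B8KnitLetterHprimeBounds (norm_hom_apply_le_of_hasMajorantHom_exp knit_E6_constLev)
open scoped Matrix Matrix.Norms.L2Operator

variable {d ℓ : ℕ} {hd : 1 ≤ d + 1} {hL : Odd (ℓ + 1) ∧ 1 < ℓ + 1} {b₀ b₁ : ℝ}
variable (i : KIdx d ℓ hd hL b₀ b₁)

/-! ## §1 Generic letters: the short word `G′·Q′*·X⁻¹` from the block carrier to the site carrier -/

section Generic

variable {𝔸 : Type} [NormedRing 𝔸] [NormedAlgebra ℂ 𝔸] [CompleteSpace 𝔸]
variable {ι : Type} [Fintype ι] (b : Module.Basis ι ℝ 𝔸)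
variable [Fintype (geo9K i).Site] [DecidableEq (geo9K i).Site] {Rr : ℝ} {Hp : Prop} (ιB : BlkY i → IBondY i)
variable (parS : SiteParY 𝔸 i) (Gp : SiteOpY 𝔸 i) (U : CfgY 𝔸 i)

omit [Fintype (geo9K i).Site] [DecidableEq (geo9K i).Site] in
/-- the scale weights of the short word: `(tG′)·Q′*·(sX⁻¹) = (t·s)·G′Q′*X⁻¹`. [cite: Balaban1985BackgroundPropagators, (3.24)–(3.25) p.394, bookkeeping] -/
theorem smul_shortword_restrictScalars (t s : ℝ) :
    (t • (Gp U).restrictScalars ℝ) ∘ₗ (QpsY i parS U).restrictScalars ℝ ∘ₗ (s • (XinvY i parS Gp U).restrictScalars ℝ)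
      = (t * s) • (Gp U ∘ₗ QpsY i parS U ∘ₗ XinvY i parS Gp U).restrictScalars ℝ := by
  simp only [LinearMap.smul_comp, LinearMap.comp_smul, smul_smul, mul_comm s t]
  rfl

omit [Fintype (geo9K i).Site] [DecidableEq (geo9K i).Site] in
/-- the short word in real coordinates. [cite: Balaban1984PropagatorsII, (2.51)–(2.52) p.232, bookkeeping] -/
theorem conjHom_shortword (t s : ℝ) :
    conj b (t • (Gp U).restrictScalars ℝ) ∘ₗ conjHom b ((QpsY i parS U).restrictScalars ℝ) ∘ₗ conj b (s • (XinvY i parS Gp U).restrictScalars ℝ)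
      = conjHom b ((t • (Gp U).restrictScalars ℝ) ∘ₗ (QpsY i parS U).restrictScalars ℝ ∘ₗ (s • (XinvY i parS Gp U).restrictScalars ℝ)) := by
  simp only [← conjHom_eq_conj, conjHom_comp]

/-- ★★ **THE SHORT WORD `(tG′)·Q′*·(sX⁻¹)` TYPED BLOCK CARRIER → SITE CARRIER** (p. 399 «using again Lemma 2.1», once): contractive transporters, a real basis `b`
(coordinate bound `M₂`), the geometry ((2.54), `d ≧ 0`, (2.61) at `β`, the scale transfer of `ℓ⁻⁴` at exponent `α` with constant `Λ ≧ 0`), `0 ≦ ρ`,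
`ρ + (α+β)δ₀ ≦ δ`; the DISPLAYED (3.42)₁ majorant `A·ℓ²·e^{−δd}` of `conj b(tG′)` and the DISPLAYED (3.48)-shape majorant `K·ℓ⁻⁴·e^{−δd}` of `conj b(sX⁻¹)` ⟹
`conj b(tG′) ∘ conjHom b(Q′*) ∘ conj b(sX⁻¹) ≺ ((M₂Σ‖b_j‖)·A·K·Λ·c₁(δ₀,β)) · (ℓ(a)²·ℓ(a)⁻⁴) · e^{−ρd}`.
[cite: Balaban1985BackgroundPropagators, (3.49) p.399, Thm 3.1 (3.42) p.397, Thm 3.2 (3.48) p.398, p.398 (scale transfer), (3.24) p.394; Balaban1984PropagatorsII, (2.52) p.232, Lemma 2.1 (2.61) p.234] -/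
theorem hasMajorantHom_shortword (hpar : ∀ z w : SiteY i, ‖(parS U z w : 𝔸)‖ ≤ 1 ∧ ‖(((parS U z w)⁻¹ : 𝔸ˣ) : 𝔸)‖ ≤ 1)
    {M₂ : ℝ} (hM₂ : 0 ≤ M₂) (hrepr : ∀ (v : 𝔸) (j : ι), |b.repr v j| ≤ M₂ * ‖v‖)
    (d₁ : ℕ) {δ₀ δ α βx ρ Λ A K t s : ℝ} (hA : 0 ≤ A) (hK : 0 ≤ K) (hΛ : 0 ≤ Λ) (hρ : 0 ≤ ρ) (hα : 0 ≤ α) (hβ : 0 ≤ βx) (hδ₀ : 0 ≤ δ₀)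
    (hr : ρ + (α + βx) * δ₀ ≤ δ)
    (hdnn : ∀ a a' : (geo9K i).Site, 0 ≤ (geo9K i).dist a a') (htri : Triangle254 (toB6 (geo9K i) Rr Hp))
    (h261 : Ineq261 d₁ (toB6 (geo9K i) Rr Hp) δ₀ βx)
    (hT4 : ScaleTransfer (geo9K i) δ₀ α Λ (fun a => ((geo9K i).len a ^ 4)⁻¹))
    (hG : HasMajorant (g := toB6 (geo9K i) Rr Hp) (fun p : SiteY i × ι => ιB (blkOf i.D.toDomains p.1))
      (conj b (t • (Gp U).restrictScalars ℝ)) (fun a a' => A * (geo9K i).len a ^ 2 * Real.exp (-(δ * (geo9K i).dist a a'))))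
    (hC : HasMajorant (g := toB6 (geo9K i) Rr Hp) (fun q : BlkY i × ι => ιB q.1)
      (conj b (s • (XinvY i parS Gp U).restrictScalars ℝ)) (fun a a' => K * ((geo9K i).len a ^ 4)⁻¹ * Real.exp (-(δ * (geo9K i).dist a a')))) :
    HasMajorantHom (g := toB6 (geo9K i) Rr Hp) (fun q : BlkY i × ι => ιB q.1) (fun p : SiteY i × ι => ιB (blkOf i.D.toDomains p.1))
      (conj b (t • (Gp U).restrictScalars ℝ) ∘ₗ conjHom b ((QpsY i parS U).restrictScalars ℝ) ∘ₗ conj b (s • (XinvY i parS Gp U).restrictScalars ℝ))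
      (fun a a' => ((M₂ * ∑ j, ‖b j‖) * A * K * Λ * B6.c1 d₁ δ₀ βx) * ((geo9K i).len a ^ 2 * ((geo9K i).len a ^ 4)⁻¹) *
        Real.exp (-(ρ * (geo9K i).dist a a'))) := by
  set blkS : SiteY i × ι → (geo9K i).Site := fun p => ιB (blkOf i.D.toDomains p.1) with hblkS
  set blkB : BlkY i × ι → (geo9K i).Site := fun q => ιB q.1 with hblkB
  have hκ : 0 ≤ M₂ * ∑ j, ‖b j‖ := mul_nonneg hM₂ (Finset.sum_nonneg fun j _ => norm_nonneg (b j))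
  have hw2 : ∀ a : (geo9K i).Site, 0 ≤ (geo9K i).len a ^ 2 := fun a => sq_nonneg _
  have hw4 : ∀ a : (geo9K i).Site, 0 ≤ ((geo9K i).len a ^ 4)⁻¹ := fun a => inv_nonneg.mpr (by positivity)
  have hρδ : ρ ≤ δ := by nlinarith [mul_nonneg (add_nonneg hα hβ) hδ₀]
  have hGh : HasMajorantHom (g := toB6 (geo9K i) Rr Hp) blkS blkS (conj b (t • (Gp U).restrictScalars ℝ))
      (fun a a' => A * (geo9K i).len a ^ 2 * Real.exp (-(δ * (geo9K i).dist a a'))) :=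
    (hasMajorantHom_iff (g := toB6 (geo9K i) Rr Hp) blkS _ _).mpr hG
  -- the last two factors at rate `ρ`
  have hCh : HasMajorantHom (g := toB6 (geo9K i) Rr Hp) blkB blkB (conj b (s • (XinvY i parS Gp U).restrictScalars ℝ))
      (fun a a' => K * ((geo9K i).len a ^ 4)⁻¹ * Real.exp (-(ρ * (geo9K i).dist a a'))) :=
    hasMajorantHom_rate_mono (R := Rr) (H := Hp) blkB blkB K (fun a => ((geo9K i).len a ^ 4)⁻¹) hK hw4 hρδ hdnn
      ((hasMajorantHom_iff (g := toB6 (geo9K i) Rr Hp) blkB _ _).mpr hC)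
  have hKC : ∀ a a' : (geo9K i).Site, 0 ≤ K * ((geo9K i).len a ^ 4)⁻¹ * Real.exp (-(ρ * (geo9K i).dist a a')) := fun a a' =>
    mul_nonneg (mul_nonneg hK (hw4 a)) (Real.exp_nonneg _)
  have s2 : HasMajorantHom (g := toB6 (geo9K i) Rr Hp) blkB blkS
      (conjHom b ((QpsY i parS U).restrictScalars ℝ) ∘ₗ conj b (s • (XinvY i parS Gp U).restrictScalars ℝ))
      (fun a a' => ((M₂ * ∑ j, ‖b j‖) * K) * ((geo9K i).len a ^ 4)⁻¹ * Real.exp (-(ρ * (geo9K i).dist a a'))) :=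
    hasMajorantHom_mono (g := toB6 (geo9K i) Rr Hp) blkB blkS
      (hasMajorantHom_local_comp (R := Rr) (H := Hp) blkB blkB blkS (M₂ * ∑ j, ‖b j‖) hKC
        (hasMajorantHom_conjHom_QpsY i b ιB parS U hpar hM₂ hrepr) hCh) fun a a' => le_of_eq (by ring)
  -- compose with `conj(tG′)` (transfer of `ℓ⁻⁴`)
  have s3 := hasMajorantHom_comp_decay (R := Rr) (H := Hp) blkB blkS blkS d₁ δ₀ α βx ρ δ Λ A ((M₂ * ∑ j, ‖b j‖) * K)
    (fun a => (geo9K i).len a ^ 2) (fun a => ((geo9K i).len a ^ 4)⁻¹) hw2 hw4 hΛ hA (mul_nonneg hκ hK) hρ hr hdnn htri hT4 h261 hGh s2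
  exact hasMajorantHom_mono (g := toB6 (geo9K i) Rr Hp) blkB blkS s3 fun a a' => le_of_eq (by ring)

/-- ★★ **THE TWO-SPACE MAJORANT OF `(t·s)·G′Q′*X⁻¹` AT GENERIC LETTERS** (the operator `Δ′_a·H′`, up to the units `t·s`): under the hypotheses of
`hasMajorantHom_shortword`, `conjHom b((t·s)·G′Q′*X⁻¹) ≺ (M₂Σ‖b_j‖)AKΛc₁ · ℓ(a)⁻² · e^{−ρd}`.
[cite: Balaban1985RegularSpaces, (1.91)–(1.92) p.91; Balaban1985BackgroundPropagators, Thm 3.1 (3.42) p.397, Thm 3.2 (3.48) p.398, (3.49) p.399, (3.24)–(3.25) p.394] -/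
theorem hasMajorantHom_conj_GQC (hpar : ∀ z w : SiteY i, ‖(parS U z w : 𝔸)‖ ≤ 1 ∧ ‖(((parS U z w)⁻¹ : 𝔸ˣ) : 𝔸)‖ ≤ 1)
    {M₂ : ℝ} (hM₂ : 0 ≤ M₂) (hrepr : ∀ (v : 𝔸) (j : ι), |b.repr v j| ≤ M₂ * ‖v‖)
    (d₁ : ℕ) {δ₀ δ α βx ρ Λ A K t s : ℝ} (hA : 0 ≤ A) (hK : 0 ≤ K) (hΛ : 0 ≤ Λ) (hρ : 0 ≤ ρ) (hα : 0 ≤ α) (hβ : 0 ≤ βx) (hδ₀ : 0 ≤ δ₀)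
    (hr : ρ + (α + βx) * δ₀ ≤ δ)
    (hdnn : ∀ a a' : (geo9K i).Site, 0 ≤ (geo9K i).dist a a') (htri : Triangle254 (toB6 (geo9K i) Rr Hp))
    (h261 : Ineq261 d₁ (toB6 (geo9K i) Rr Hp) δ₀ βx)
    (hT4 : ScaleTransfer (geo9K i) δ₀ α Λ (fun a => ((geo9K i).len a ^ 4)⁻¹))
    (hG : HasMajorant (g := toB6 (geo9K i) Rr Hp) (fun p : SiteY i × ι => ιB (blkOf i.D.toDomains p.1))
      (conj b (t • (Gp U).restrictScalars ℝ)) (fun a a' => A * (geo9K i).len a ^ 2 * Real.exp (-(δ * (geo9K i).dist a a'))))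
    (hC : HasMajorant (g := toB6 (geo9K i) Rr Hp) (fun q : BlkY i × ι => ιB q.1)
      (conj b (s • (XinvY i parS Gp U).restrictScalars ℝ)) (fun a a' => K * ((geo9K i).len a ^ 4)⁻¹ * Real.exp (-(δ * (geo9K i).dist a a')))) :
    HasMajorantHom (g := toB6 (geo9K i) Rr Hp) (fun q : BlkY i × ι => ιB q.1) (fun p : SiteY i × ι => ιB (blkOf i.D.toDomains p.1))
      (conjHom b ((t * s) • (Gp U ∘ₗ QpsY i parS U ∘ₗ XinvY i parS Gp U).restrictScalars ℝ))
      (fun a a' => ((M₂ * ∑ j, ‖b j‖) * A * K * Λ * B6.c1 d₁ δ₀ βx) * ((geo9K i).len a ^ 2)⁻¹ * Real.exp (-(ρ * (geo9K i).dist a a'))) := by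
  have hlen : ∀ a : (geo9K i).Site, 0 < (geo9K i).len a := fun a => by rw [geo9K_len_kGeo]; exact len_pos i a
  have h := hasMajorantHom_shortword i b ιB parS Gp U hpar hM₂ hrepr d₁ hA hK hΛ hρ hα hβ hδ₀ hr hdnn htri h261 hT4 hG hC
  rw [conjHom_shortword, smul_shortword_restrictScalars] at h
  refine hasMajorantHom_mono (g := toB6 (geo9K i) Rr Hp) _ _ h fun a a' => le_of_eq ?_
  have ha : (geo9K i).len a ≠ 0 := (hlen a).ne'
  field_simp

end Generic

/-! ## §2 The averaging term of `Δ′_a(U)` at a `G`-valued transporter letter: a block average of weight `a_j(Lʲ)⁻²` -/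

section AvgTerm

variable {N : ℕ} {G : Subgroup (Matrix (Fin N) (Fin N) ℂ)ˣ}

/-- ★★ **THE AVERAGING TERM `Σ_w a(z,w)·R(τ(z,w))Λ(w)` OF def-Y's `Δ′_a(U)` IS SMALL OF ORDER `a_j(Lʲ)⁻²`** (lattice units; (3.24)'s
`a_j(Lʲη)⁻²Q′_j*Q′_j`, [4] (2.14)): for `G ≤ U(N)` (`N ≥ 1`) and a `G`-valued transporter letter,
`‖Σ_w a(z,w)·R(τ)Λ(w)‖ ≦ a_{j(s)}·(L^{j(s)})⁻²·M` whenever `‖Λ‖ ≦ M` on the block `s` of `z` (the `L^{j(s)(d+1)}` sites of the block against the weight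
`levC = a_j L^{−2j}L^{−j(d+1)}`; each conjugation is a contraction). [cite: Balaban1985BackgroundPropagators, (3.24) p.394, (3.19) p.393; Balaban1984PropagatorsII, (2.14) p.225] -/
theorem norm_avgTerm_apply_le [Nonempty (Fin N)] (hG : G ≤ B7Prop2Explicit.unitaryUnits (Matrix (Fin N) (Fin N) ℂ))
    (par : SiteParY (Matrix (Fin N) (Fin N) ℂ) i) (U : CfgY (Matrix (Fin N) (Fin N) ℂ) i) (hpar : ∀ z w : SiteY i, par U z w ∈ G)
    (Λ : SiteY i → Matrix (Fin N) (Fin N) ℂ) {z : SiteY i} {s : BlkY i} (hz : blkOf i.D.toDomains z = s) {M : ℝ}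
    (hΛ : ∀ w : SiteY i, blkOf i.D.toDomains w = s → ‖Λ w‖ ≤ M) :
    ‖∑ w, ((avgCoeffY i z w : ℝ) : ℂ) • R (avgTrY i par U z w) (Λ w)‖
      ≤ aPrinted ℓ 1 s.1.1 * ((((ℓ + 1) ^ s.1.1 : ℕ) : ℝ) ^ 2)⁻¹ * M := by
  classical
  set B := Finset.univ.filter (fun w : SiteY i => blkOf i.D.toDomains w = s) with hB
  have hmem : ∀ {w}, w ∈ B → blkOf i.D.toDomains w = s := fun {w} hw => by simpa [hB] using hw
  have hsum : ∑ w, ((avgCoeffY i z w : ℝ) : ℂ) • R (avgTrY i par U z w) (Λ w)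
      = ((levC d ℓ (aPrinted ℓ 1) s.1.1 : ℝ) : ℂ) • ∑ w ∈ B, R (avgTrY i par U z w) (Λ w) := by
    rw [Finset.smul_sum, ← Finset.sum_filter_add_sum_filter_not Finset.univ (fun w : SiteY i => blkOf i.D.toDomains w = s)]
    have h0 : ∑ w ∈ Finset.univ.filter (fun w : SiteY i => ¬ blkOf i.D.toDomains w = s),
        ((avgCoeffY i z w : ℝ) : ℂ) • R (avgTrY i par U z w) (Λ w) = 0 :=
      Finset.sum_eq_zero fun w hw => by
        have hw' : ¬ blkOf i.D.toDomains w = s := (Finset.mem_filter.1 hw).2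
        rw [avgCoeffY_eq_ite, if_neg (by rw [hz]; exact hw'), Complex.ofReal_zero, zero_smul]
    rw [h0, add_zero]
    refine Finset.sum_congr rfl fun w hw => ?_
    rw [avgCoeffY_eq_ite, if_pos (by rw [hz]; exact hmem hw), levY_of_blkOf i hz]
  have hterm : ∀ w ∈ B, ‖R (avgTrY i par U z w) (Λ w)‖ ≤ M := by
    intro w hw
    have hmemG : avgTrY i par U z w ∈ G := G.mul_mem (hpar _ _) (hpar _ _)
    exact (norm_R_le_of_unit _ _ (contraction_of_mem_unitary hG hmemG)).trans (hΛ w (hmem hw))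
  have hcard : (B.card : ℝ) = (((ℓ + 1) ^ s.1.1 : ℕ) : ℝ) ^ (d + 1) := by
    rw [hB, ← filter_rblk_eq_filter_blkOf i s,
      B4Lower18.card_filter_rblk (le_trans one_le_two (two_le_side i s)) (isBlockUnion_XB i (scale_bounds i.D.toDomains s).2)]
    push_cast; ring
  have hκ : 0 ≤ levC d ℓ (aPrinted ℓ 1) s.1.1 := (levC_blk_pos i s).le
  rw [hsum, norm_smul, Complex.norm_real, Real.norm_of_nonneg hκ]
  calc levC d ℓ (aPrinted ℓ 1) s.1.1 * ‖∑ w ∈ B, R (avgTrY i par U z w) (Λ w)‖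
      ≤ levC d ℓ (aPrinted ℓ 1) s.1.1 * ∑ w ∈ B, ‖R (avgTrY i par U z w) (Λ w)‖ := mul_le_mul_of_nonneg_left (norm_sum_le _ _) hκ
    _ ≤ levC d ℓ (aPrinted ℓ 1) s.1.1 * ∑ _w ∈ B, M := mul_le_mul_of_nonneg_left (Finset.sum_le_sum hterm) hκ
    _ = levC d ℓ (aPrinted ℓ 1) s.1.1 * (((ℓ + 1) ^ s.1.1 : ℕ) : ℝ) ^ (d + 1) * M := by rw [Finset.sum_const, nsmul_eq_mul, hcard]; ring
    _ = aPrinted ℓ 1 s.1.1 * ((((ℓ + 1) ^ s.1.1 : ℕ) : ℝ) ^ 2)⁻¹ * M := by rw [levC_mul_side_pow i s]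

/-- … and `a_j ≦ 1`: `(L^{j(s)})²·‖Σ_w a(z,w)·R(τ)Λ(w)‖ ≦ M`. [cite: Balaban1984PropagatorsII, (2.14) p.225, Prop. 2.2 p.234 («(a = 1)»); Balaban1985BackgroundPropagators, (3.24) p.394] -/
theorem norm_avgTerm_apply_le' [Nonempty (Fin N)] (hG : G ≤ B7Prop2Explicit.unitaryUnits (Matrix (Fin N) (Fin N) ℂ))
    (par : SiteParY (Matrix (Fin N) (Fin N) ℂ) i) (U : CfgY (Matrix (Fin N) (Fin N) ℂ) i) (hpar : ∀ z w : SiteY i, par U z w ∈ G)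
    (Λ : SiteY i → Matrix (Fin N) (Fin N) ℂ) {z : SiteY i} {s : BlkY i} (hz : blkOf i.D.toDomains z = s) {M : ℝ} (hM : 0 ≤ M)
    (hΛ : ∀ w : SiteY i, blkOf i.D.toDomains w = s → ‖Λ w‖ ≤ M) :
    (((ℓ + 1 : ℕ) : ℝ)) ^ s.1.1 * (((ℓ + 1 : ℕ) : ℝ)) ^ s.1.1 * ‖∑ w, ((avgCoeffY i z w : ℝ) : ℂ) • R (avgTrY i par U z w) (Λ w)‖ ≤ M := by
  have h := norm_avgTerm_apply_le i hG par U hpar Λ hz hΛ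
  have ha1 : aPrinted ℓ 1 s.1.1 ≤ 1 := B6Prop23KLevelTorusCensus.aPrinted_le_one (by have := i.hℓ; omega) _ (one_le_level i s)
  have ha0 : 0 ≤ aPrinted ℓ 1 s.1.1 := (B6Prop23KLevelTorusCensus.aPrinted_pos (by have := i.hℓ; omega) _ (one_le_level i s)).le
  have hn : (0 : ℝ) < (((ℓ + 1) ^ s.1.1 : ℕ) : ℝ) := by positivity
  have e1 : (((ℓ + 1 : ℕ) : ℝ)) ^ s.1.1 = (((ℓ + 1) ^ s.1.1 : ℕ) : ℝ) := by push_cast; ring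
  rw [e1]
  calc (((ℓ + 1) ^ s.1.1 : ℕ) : ℝ) * (((ℓ + 1) ^ s.1.1 : ℕ) : ℝ) * ‖∑ w, ((avgCoeffY i z w : ℝ) : ℂ) • R (avgTrY i par U z w) (Λ w)‖
      ≤ (((ℓ + 1) ^ s.1.1 : ℕ) : ℝ) * (((ℓ + 1) ^ s.1.1 : ℕ) : ℝ) * (aPrinted ℓ 1 s.1.1 * ((((ℓ + 1) ^ s.1.1 : ℕ) : ℝ) ^ 2)⁻¹ * M) :=
        mul_le_mul_of_nonneg_left h (by positivity)
    _ = aPrinted ℓ 1 s.1.1 * M := by field_simp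
    _ ≤ 1 * M := mul_le_mul_of_nonneg_right ha1 hM
    _ = M := one_mul M

end AvgTerm

/-! ## §3 At the knit letter: `lapS(H′Y) = G′Q′*CY − avg(H′Y)` and the consumer's (E8) -/

section Knit

variable {N : ℕ} {G : Subgroup (Matrix (Fin N) (Fin N) ℂ)ˣ}
variable {ι : Type} [Fintype ι] (b : Module.Basis ι ℝ (Matrix (Fin N) (Fin N) ℂ))
variable [Fintype (geo9K i).Site] [DecidableEq (geo9K i).Site] {Rr : ℝ} {Hp : Prop} (ιB : BlkY i → IBondY i)

omit [Fintype ι] [Fintype (geo9K i).Site] [DecidableEq (geo9K i).Site] in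
/-- ★ **`Δ_U(H′Y) = G′Q′*CY − avg(H′Y)` AT THE KNIT LETTER** (lattice units; `Δ′_aG′ = 1`, (3.24)): def-Y's covariant Laplacian of `H′Y`, `H′ = G′²Q′*C`, IS
`G′(Q′*(CY))` minus the averaging term of `Δ′_a` at `H′Y`. [cite: Balaban1985BackgroundPropagators, (3.24) p.394, p.394 («Its inverse is denoted by G′»); Balaban1985RegularSpaces, (1.91) p.91] -/
theorem lapS_Hprime_apply (hG : G ≤ B7Prop2Explicit.unitaryUnits (Matrix (Fin N) (Fin N) ℂ)) {U : CfgY (Matrix (Fin N) (Fin N) ℂ) i}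
    (hU : ∀ μ x, U μ x ∈ G) (hpar : ∀ z w : SiteY i, parKnitY i U z w ∈ G) (Y : BlkY i → Matrix (Fin N) (Fin N) ℂ) (z : SiteY i) :
    lapS i U (GpY i (parKnitY i) U (GpY i (parKnitY i) U (QpsY i (parKnitY i) U (XinvY i (parKnitY i) (GpY i (parKnitY i)) U Y)))) z
      = GpY i (parKnitY i) U (QpsY i (parKnitY i) U (XinvY i (parKnitY i) (GpY i (parKnitY i)) U Y)) z
        - ∑ w, ((avgCoeffY i z w : ℝ) : ℂ) • R (avgTrY i (parKnitY i) U z w)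
            (GpY i (parKnitY i) U (GpY i (parKnitY i) U (QpsY i (parKnitY i) U (XinvY i (parKnitY i) (GpY i (parKnitY i)) U Y))) w) := by
  rw [← deltaPrimeAY_sub_lapS, deltaPrimeAY_GpY_parKnitY_apply i hG hU hpar]
  abel

omit [Fintype ι] [Fintype (geo9K i).Site] [DecidableEq (geo9K i).Site] in
/-- arithmetic of the `(−2)`-weighted line: `(η²)⁻¹x ≦ S·(κ((Lη)²)⁻¹c·m) ⇒ L²x ≦ S·(κc·m)` (`L, η > 0`). [cite: Balaban1985RegularSpaces, (1.92) p.91, bookkeeping] -/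
theorem scale_aux2 {L η x S κ c m : ℝ} (hL : 0 < L) (hη : 0 < η) (h : (η ^ 2)⁻¹ * x ≤ S * (κ * ((L * η) ^ 2)⁻¹ * c * m)) :
    L ^ 2 * x ≤ S * (κ * c * m) := by
  have hLη : 0 < (L * η) ^ 2 := by positivity
  have h' := mul_le_mul_of_nonneg_left h hLη.le
  have e1 : (L * η) ^ 2 * ((η ^ 2)⁻¹ * x) = L ^ 2 * x := by field_simp
  have e2 : (L * η) ^ 2 * (S * (κ * ((L * η) ^ 2)⁻¹ * c * m)) = S * (κ * c * m) := by field_simp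
  rw [e1, e2] at h'
  exact h'

/-- ★★ **`L^{2n}·‖(G′Q′*CY)(z)‖ ≦ (Σ‖b_j‖)κ′cM₂·sup‖Y‖` AT THE KNIT LETTER, CONSTANT-LEVEL MEMBER** (the `Δ′_a(H′Y)` piece of (E8); `κ′ = (M₂Σ‖b_j‖)AKc₁`): for `G ≤ U(N)`
(`N ≥ 1`), `G`-valued knit legs, print's units `c_f = L^k`, the geometry ((2.54), `d ≧ 0`, (2.61) at `β`), `ρ + βδ₀ ≦ δ`, `η²·η²·s = 1` (`η = etaS i`), the two
DISPLAYED majorants and the row sum at `ρ`. [cite: Balaban1985RegularSpaces, (1.92) p.91, p.77 («Ω_j = T_η»); Balaban1985BackgroundPropagators, Thm 3.1 (3.42) p.397, Thm 3.2 (3.48) p.398, (3.49) p.399, (3.24) p.394] -/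
theorem sqL_norm_GQC_parKnitY_apply_le [Nonempty (Fin N)] {n : ℕ} (hlev : ∀ z : SiteY i, levY i z = n) (hcf : i.cf = (((ℓ + 1 : ℕ) : ℝ)) ^ i.k)
    (hG : G ≤ B7Prop2Explicit.unitaryUnits (Matrix (Fin N) (Fin N) ℂ))
    {U : CfgY (Matrix (Fin N) (Fin N) ℂ) i} (hpar : ∀ z w : SiteY i, parKnitY i U z w ∈ G)
    {M₂ : ℝ} (hM₂ : 0 ≤ M₂) (hrepr : ∀ (v : Matrix (Fin N) (Fin N) ℂ) (j : ι), |b.repr v j| ≤ M₂ * ‖v‖)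
    (d₁ : ℕ) {δ₀ δ βx ρ A K s c : ℝ} (hA : 0 ≤ A) (hK : 0 ≤ K) (hρ : 0 ≤ ρ) (hβ : 0 ≤ βx) (hδ₀ : 0 ≤ δ₀) (hr : ρ + βx * δ₀ ≤ δ)
    (hs : (etaS i ^ 2 * etaS i ^ 2) * s = 1)
    (hdnn : ∀ a a' : (geo9K i).Site, 0 ≤ (geo9K i).dist a a') (htri : Triangle254 (toB6 (geo9K i) Rr Hp))
    (h261 : Ineq261 d₁ (toB6 (geo9K i) Rr Hp) δ₀ βx)
    (hGm : HasMajorant (g := toB6 (geo9K i) Rr Hp) (fun p : SiteY i × ι => ιB (blkOf i.D.toDomains p.1))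
      (conj b ((etaS i ^ 2) • (GpY i (parKnitY i) U).restrictScalars ℝ)) (fun a a' => A * (geo9K i).len a ^ 2 * Real.exp (-(δ * (geo9K i).dist a a'))))
    (hC : HasMajorant (g := toB6 (geo9K i) Rr Hp) (fun q : BlkY i × ι => ιB q.1)
      (conj b (s • (XinvY i (parKnitY i) (GpY i (parKnitY i)) U).restrictScalars ℝ))
      (fun a a' => K * ((geo9K i).len a ^ 4)⁻¹ * Real.exp (-(δ * (geo9K i).dist a a'))))
    (hrow : ∀ a : (geo9K i).Site, ∑ a' : (geo9K i).Site, Real.exp (-(ρ * (geo9K i).dist a a')) ≤ c)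
    (Y : BlkY i → Matrix (Fin N) (Fin N) ℂ) {M : ℝ} (hY : ∀ s, ‖Y s‖ ≤ M) (z : SiteY i) :
    ((((ℓ + 1 : ℕ) : ℝ)) ^ n) ^ 2 * ‖GpY i (parKnitY i) U (QpsY i (parKnitY i) U (XinvY i (parKnitY i) (GpY i (parKnitY i)) U Y)) z‖
      ≤ (∑ j, ‖b j‖) * (((M₂ * ∑ j, ‖b j‖) * A * K * B6.c1 d₁ δ₀ βx) * c * (M₂ * M)) := by
  have hη : 0 < etaS i := etaS_pos i
  have hLn : (0 : ℝ) < (((ℓ + 1 : ℕ) : ℝ)) ^ n := by positivity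
  have hpos : (0 : ℝ) < (((ℓ + 1 : ℕ) : ℝ)) ^ i.k := by positivity
  have hlen2 : ∀ a : (geo9K i).Site, 0 ≤ ((geo9K i).len a ^ 2)⁻¹ := fun a => inv_nonneg.2 (sq_nonneg _)
  have hr' : ρ + (0 + βx) * δ₀ ≤ δ := by rw [zero_add]; exact hr
  have hH := hasMajorantHom_conj_GQC i b ιB (parKnitY i) (GpY i (parKnitY i)) U (parKnitY_contractive i hG hpar) hM₂ hrepr d₁ hA hK zero_le_one hρ le_rfl hβ
    hδ₀ hr' hdnn htri h261 (scaleTransfer_of_constLev i hlev δ₀ fun x => (x ^ 4)⁻¹) hGm hC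
  have hκ : 0 ≤ (M₂ * ∑ j, ‖b j‖) * A * K * (1 : ℝ) * B6.c1 d₁ δ₀ βx := by
    have := c1_nonneg d₁ δ₀ βx
    have : 0 ≤ ∑ j, ‖b j‖ := Finset.sum_nonneg fun _ _ => norm_nonneg _
    positivity
  have h := norm_hom_apply_le_of_hasMajorantHom_exp i b ιB _ hκ hlen2 hH hrow hM₂ hrepr Y hY z
  have happ : ((etaS i ^ 2 * s) • (GpY i (parKnitY i) U ∘ₗ QpsY i (parKnitY i) U ∘ₗ XinvY i (parKnitY i) (GpY i (parKnitY i)) U).restrictScalars ℝ) Y z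
      = (etaS i ^ 2 * s) • GpY i (parKnitY i) U (QpsY i (parKnitY i) U (XinvY i (parKnitY i) (GpY i (parKnitY i)) U Y)) z := rfl
  have hts : etaS i ^ 2 * s = (etaS i ^ 2)⁻¹ := eq_inv_of_mul_eq_one_right (by rw [← mul_assoc]; exact hs)
  rw [happ, hts, norm_smul, Real.norm_of_nonneg (inv_nonneg.2 (sq_nonneg _)), geo9K_len_constLev i hlev, hcf, abs_of_pos hpos, mul_one] at h
  have hk : nKT (toKT i) = (ℓ + 1) ^ i.k := rfl
  have hq : ((((ℓ + 1 : ℕ) : ℝ)) ^ n / (((ℓ + 1 : ℕ) : ℝ)) ^ i.k) ^ 2 = ((((ℓ + 1 : ℕ) : ℝ)) ^ n * etaS i) ^ 2 := by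
    unfold etaS; rw [hk, div_eq_mul_inv]; push_cast; ring
  rw [hq] at h
  exact scale_aux2 hLn hη h

/-- ★★★ **(E8) `hp_lap` AT THE KNIT LETTER, CONSTANT-LEVEL MEMBER, LATTICE UNITS** ([B8] (1.92) `(Lʲη)²|Δ^η_{U₀}H′X| ≦ B₀|X|`): under the hypotheses of
`sqL_norm_GQC_parKnitY_apply_le` (`ρ + 2βδ₀ ≦ δ` for the (E6) part) and a `G`-valued `U`: `‖Y(s)‖ ≦ M ∀s ⇒ L^{2j}·‖Δ_U(H′Y)(z)‖ ≦
(Σ‖b_j‖)·((M₂Σ‖b_j‖)AKc₁ + (M₂Σ‖b_j‖)A²Kc₁²)·c·M₂·M` for every `j ≦ n` (`Δ_U = lapS`, def-Y's unit-lattice covariant Laplacian; `H′ = G′²Q′*C`).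
[cite: Balaban1985RegularSpaces, (1.91)–(1.92) p.91, p.77 («Ω_j = T_η»); Balaban1985BackgroundPropagators, (3.24) p.394, Thm 3.1 (3.42) p.397, Thm 3.2 (3.48) p.398, (3.49) p.399; Balaban1984PropagatorsII, (2.14) p.225, (2.61) p.234] -/
theorem knit_E8_constLev [Nonempty (Fin N)] {n : ℕ} (hlev : ∀ z : SiteY i, levY i z = n) (hcf : i.cf = (((ℓ + 1 : ℕ) : ℝ)) ^ i.k)
    (hG : G ≤ B7Prop2Explicit.unitaryUnits (Matrix (Fin N) (Fin N) ℂ))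
    {U : CfgY (Matrix (Fin N) (Fin N) ℂ) i} (hU : ∀ μ x, U μ x ∈ G) (hpar : ∀ z w : SiteY i, parKnitY i U z w ∈ G)
    {M₂ : ℝ} (hM₂ : 0 ≤ M₂) (hrepr : ∀ (v : Matrix (Fin N) (Fin N) ℂ) (j : ι), |b.repr v j| ≤ M₂ * ‖v‖)
    (d₁ : ℕ) {δ₀ δ βx ρ A K s c : ℝ} (hA : 0 ≤ A) (hK : 0 ≤ K) (hρ : 0 ≤ ρ) (hβ : 0 ≤ βx) (hδ₀ : 0 ≤ δ₀) (hr : ρ + 2 * (βx * δ₀) ≤ δ)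
    (hs : (etaS i ^ 2 * etaS i ^ 2) * s = 1)
    (hdnn : ∀ a a' : (geo9K i).Site, 0 ≤ (geo9K i).dist a a') (htri : Triangle254 (toB6 (geo9K i) Rr Hp))
    (h261 : Ineq261 d₁ (toB6 (geo9K i) Rr Hp) δ₀ βx)
    (hGm : HasMajorant (g := toB6 (geo9K i) Rr Hp) (fun p : SiteY i × ι => ιB (blkOf i.D.toDomains p.1))
      (conj b ((etaS i ^ 2) • (GpY i (parKnitY i) U).restrictScalars ℝ)) (fun a a' => A * (geo9K i).len a ^ 2 * Real.exp (-(δ * (geo9K i).dist a a'))))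
    (hC : HasMajorant (g := toB6 (geo9K i) Rr Hp) (fun q : BlkY i × ι => ιB q.1)
      (conj b (s • (XinvY i (parKnitY i) (GpY i (parKnitY i)) U).restrictScalars ℝ))
      (fun a a' => K * ((geo9K i).len a ^ 4)⁻¹ * Real.exp (-(δ * (geo9K i).dist a a'))))
    (hrow : ∀ a : (geo9K i).Site, ∑ a' : (geo9K i).Site, Real.exp (-(ρ * (geo9K i).dist a a')) ≤ c)
    (Y : BlkY i → Matrix (Fin N) (Fin N) ℂ) {M : ℝ} (hY : ∀ s, ‖Y s‖ ≤ M) {j : ℕ} (hj : j ≤ n) (z : SiteY i) :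
    ((((ℓ + 1 : ℕ) : ℝ)) ^ j) ^ 2 *
        ‖lapS i U (GpY i (parKnitY i) U (GpY i (parKnitY i) U (QpsY i (parKnitY i) U (XinvY i (parKnitY i) (GpY i (parKnitY i)) U Y)))) z‖
      ≤ (∑ j, ‖b j‖) * (((M₂ * ∑ j, ‖b j‖) * A * K * B6.c1 d₁ δ₀ βx) * c * (M₂ * M))
        + (∑ j, ‖b j‖) * (((M₂ * ∑ j, ‖b j‖) * A * A * K * B6.c1 d₁ δ₀ βx ^ 2) * c * (M₂ * M)) := by
  have hL1 : (1 : ℝ) ≤ ((ℓ + 1 : ℕ) : ℝ) := by exact_mod_cast Nat.succ_le_succ (Nat.zero_le ℓ)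
  have hLn : (0 : ℝ) < (((ℓ + 1 : ℕ) : ℝ)) ^ n := by positivity
  have hM : 0 ≤ M := (norm_nonneg _).trans (hY (blkOf i.D.toDomains z))
  have hr₁ : ρ + βx * δ₀ ≤ δ := by nlinarith [mul_nonneg hβ hδ₀]
  -- the `Δ′_a(H′Y) = G′Q′*CY` piece
  have h1 := sqL_norm_GQC_parKnitY_apply_le i b ιB hlev hcf hG hpar hM₂ hrepr d₁ hA hK hρ hβ hδ₀ hr₁ hs hdnn htri h261 hGm hC hrow Y hY z
  -- the averaging piece, through (E6)'s sup bound of `H′Y` on the block of `z`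
  have hE6 : ∀ w : SiteY i, blkOf i.D.toDomains w = blkOf i.D.toDomains z →
      ‖GpY i (parKnitY i) U (GpY i (parKnitY i) U (QpsY i (parKnitY i) U (XinvY i (parKnitY i) (GpY i (parKnitY i)) U Y))) w‖
        ≤ (∑ j, ‖b j‖) * (((M₂ * ∑ j, ‖b j‖) * A * A * K * B6.c1 d₁ δ₀ βx ^ 2) * c * (M₂ * M)) := fun w _ =>
    knit_E6_constLev i b ιB hlev hG hpar hM₂ hrepr d₁ hA hK hρ hβ hδ₀ hr hs hdnn htri h261 hGm hC hrow Y hY w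
  have hB : 0 ≤ (∑ j, ‖b j‖) * (((M₂ * ∑ j, ‖b j‖) * A * A * K * B6.c1 d₁ δ₀ βx ^ 2) * c * (M₂ * M)) :=
    (norm_nonneg _).trans (hE6 z rfl)
  have h2 := norm_avgTerm_apply_le' i hG (parKnitY i) U hpar _ rfl hB hE6
  rw [(levY_of_blkOf i rfl).symm.trans (hlev z)] at h2
  -- assemble at level `n`, then lower the weight to `j ≤ n`
  have hjn : ((((ℓ + 1 : ℕ) : ℝ)) ^ j) ^ 2 ≤ ((((ℓ + 1 : ℕ) : ℝ)) ^ n) ^ 2 :=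
    pow_le_pow_left₀ (by positivity) (pow_le_pow_right₀ hL1 hj) 2
  rw [lapS_Hprime_apply i hG hU hpar Y z]
  calc ((((ℓ + 1 : ℕ) : ℝ)) ^ j) ^ 2 * ‖GpY i (parKnitY i) U (QpsY i (parKnitY i) U (XinvY i (parKnitY i) (GpY i (parKnitY i)) U Y)) z
          - ∑ w, ((avgCoeffY i z w : ℝ) : ℂ) • R (avgTrY i (parKnitY i) U z w)
              (GpY i (parKnitY i) U (GpY i (parKnitY i) U (QpsY i (parKnitY i) U (XinvY i (parKnitY i) (GpY i (parKnitY i)) U Y))) w)‖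
      ≤ ((((ℓ + 1 : ℕ) : ℝ)) ^ n) ^ 2 * (‖GpY i (parKnitY i) U (QpsY i (parKnitY i) U (XinvY i (parKnitY i) (GpY i (parKnitY i)) U Y)) z‖
          + ‖∑ w, ((avgCoeffY i z w : ℝ) : ℂ) • R (avgTrY i (parKnitY i) U z w)
              (GpY i (parKnitY i) U (GpY i (parKnitY i) U (QpsY i (parKnitY i) U (XinvY i (parKnitY i) (GpY i (parKnitY i)) U Y))) w)‖) :=
        mul_le_mul hjn (norm_sub_le _ _) (norm_nonneg _) (by positivity)
    _ = ((((ℓ + 1 : ℕ) : ℝ)) ^ n) ^ 2 * ‖GpY i (parKnitY i) U (QpsY i (parKnitY i) U (XinvY i (parKnitY i) (GpY i (parKnitY i)) U Y)) z‖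
          + (((ℓ + 1 : ℕ) : ℝ)) ^ n * (((ℓ + 1 : ℕ) : ℝ)) ^ n * ‖∑ w, ((avgCoeffY i z w : ℝ) : ℂ) • R (avgTrY i (parKnitY i) U z w)
              (GpY i (parKnitY i) U (GpY i (parKnitY i) U (QpsY i (parKnitY i) U (XinvY i (parKnitY i) (GpY i (parKnitY i)) U Y))) w)‖ := by ring
    _ ≤ _ := add_le_add h1 h2

/-- ★★★ **(E8) `hp_lap` OF `B8Thm2TorusLetters.LettersAt` AT THE KNIT LETTER, READ THROUGH THE KNIT's OWN `Δ^{η′}_{U₀}` AT THE BOX POINTS** (J-A `covLap_liftY`: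
`Δ^{η′}_{U₀}(Φ♯)(z) = η′⁻²·lapS(Φ)(z)` for `U₀ = liftCfg U`, `Φ♯ = liftFun(Φ ∘ chart)`): under the hypotheses of `knit_E8_constLev`, for the consumer's `η′ ≠ 0`,
every `j ≦ n` and every box point `z`: `(Lʲη′)²·‖covLap η′ U₀ ((H′Y)♯)(z)‖ ≦ B₂′·M`, `B₂′ = (Σ‖b_j‖)((M₂Σ‖b_j‖)AKc₁ + (M₂Σ‖b_j‖)A²Kc₁²)cM₂` — free of the
member, `n`, `k`, `N`, `η′`. [cite: Balaban1985RegularSpaces, (1.92) p.91, (1.1) p.76, p.77 («Ω_j = T_η»); Balaban1985BackgroundPropagators, (3.23)–(3.24) p.394, Thm 3.1 (3.42) p.397, Thm 3.2 (3.48) p.398] -/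
theorem knit_E8_at_box [Nonempty (Fin N)] {n : ℕ} (hlev : ∀ z : SiteY i, levY i z = n) (hcf : i.cf = (((ℓ + 1 : ℕ) : ℝ)) ^ i.k)
    (hG : G ≤ B7Prop2Explicit.unitaryUnits (Matrix (Fin N) (Fin N) ℂ))
    {U : CfgY (Matrix (Fin N) (Fin N) ℂ) i} (hU : ∀ μ x, U μ x ∈ G) (hpar : ∀ z w : SiteY i, parKnitY i U z w ∈ G)
    {M₂ : ℝ} (hM₂ : 0 ≤ M₂) (hrepr : ∀ (v : Matrix (Fin N) (Fin N) ℂ) (j : ι), |b.repr v j| ≤ M₂ * ‖v‖)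
    (d₁ : ℕ) {δ₀ δ βx ρ A K s c : ℝ} (hA : 0 ≤ A) (hK : 0 ≤ K) (hρ : 0 ≤ ρ) (hβ : 0 ≤ βx) (hδ₀ : 0 ≤ δ₀) (hr : ρ + 2 * (βx * δ₀) ≤ δ)
    (hs : (etaS i ^ 2 * etaS i ^ 2) * s = 1)
    (hdnn : ∀ a a' : (geo9K i).Site, 0 ≤ (geo9K i).dist a a') (htri : Triangle254 (toB6 (geo9K i) Rr Hp))
    (h261 : Ineq261 d₁ (toB6 (geo9K i) Rr Hp) δ₀ βx)
    (hGm : HasMajorant (g := toB6 (geo9K i) Rr Hp) (fun p : SiteY i × ι => ιB (blkOf i.D.toDomains p.1))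
      (conj b ((etaS i ^ 2) • (GpY i (parKnitY i) U).restrictScalars ℝ)) (fun a a' => A * (geo9K i).len a ^ 2 * Real.exp (-(δ * (geo9K i).dist a a'))))
    (hC : HasMajorant (g := toB6 (geo9K i) Rr Hp) (fun q : BlkY i × ι => ιB q.1)
      (conj b (s • (XinvY i (parKnitY i) (GpY i (parKnitY i)) U).restrictScalars ℝ))
      (fun a a' => K * ((geo9K i).len a ^ 4)⁻¹ * Real.exp (-(δ * (geo9K i).dist a a'))))
    (hrow : ∀ a : (geo9K i).Site, ∑ a' : (geo9K i).Site, Real.exp (-(ρ * (geo9K i).dist a a')) ≤ c)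
    (Y : BlkY i → Matrix (Fin N) (Fin N) ℂ) {M : ℝ} (hY : ∀ s, ‖Y s‖ ≤ M) {η' : ℝ} (hη' : η' ≠ 0) {j : ℕ} (hj : j ≤ n) (z : SiteY i) :
    ((((ℓ + 1 : ℕ) : ℝ)) ^ j * η') ^ 2 *
        ‖covLap η' (liftCfg U)
            (liftFun ((GpY i (parKnitY i) U (GpY i (parKnitY i) U (QpsY i (parKnitY i) U (XinvY i (parKnitY i) (GpY i (parKnitY i)) U Y))))
              ∘ ⇑(boxEquiv i.hN))) z.1‖
      ≤ (∑ j, ‖b j‖) * (((M₂ * ∑ j, ‖b j‖) * A * K * B6.c1 d₁ δ₀ βx) * c * (M₂ * M))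
        + (∑ j, ‖b j‖) * (((M₂ * ∑ j, ‖b j‖) * A * A * K * B6.c1 d₁ δ₀ βx ^ 2) * c * (M₂ * M)) := by
  have hz : boxEquiv i.hN (transl 0 z.1) = z := boxEquiv_transl_of_mem i z.2
  have h := knit_E8_constLev i b ιB hlev hcf hG hU hpar hM₂ hrepr d₁ hA hK hρ hβ hδ₀ hr hs hdnn htri h261 hGm hC hrow Y hY hj z
  rw [covLap_liftY, hz, norm_smul, Real.norm_of_nonneg (mul_self_nonneg η'⁻¹)]
  have e : ((((ℓ + 1 : ℕ) : ℝ)) ^ j * η') ^ 2 * (η'⁻¹ * η'⁻¹ *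
      ‖lapS i U (GpY i (parKnitY i) U (GpY i (parKnitY i) U (QpsY i (parKnitY i) U (XinvY i (parKnitY i) (GpY i (parKnitY i)) U Y)))) z‖)
      = ((((ℓ + 1 : ℕ) : ℝ)) ^ j) ^ 2 *
        ‖lapS i U (GpY i (parKnitY i) U (GpY i (parKnitY i) U (QpsY i (parKnitY i) U (XinvY i (parKnitY i) (GpY i (parKnitY i)) U Y)))) z‖ := by
    field_simp
  rw [e]
  exact h

end Knit

end Literature.MathematicalPhysics.QuantumFieldTheory.Balaban1983to89.B9B8KnitLetterHprimeLap

end
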